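import Literature.Algebra.Lie.ChevalleyEilenbergDirectSum
import Literature.NumberTheory.Automorphic.GKCohomology
import HarnessLib

/-!
# `H^q(𝔤, K; −)` is a functor on `(𝔤, K)`-modules

Topic `NumberTheory/Automorphic`; namespace `Literature.NumberTheory.Automorphic`.
Definitions with bodies and theorems; no named fact, no `sorry`.  Extends the endomorphism
functoriality of `GKCohomology` (`gkCohomologyMap`, Hecke-type operators `T : V → V`) to
`(𝔤, K)`-maps **between different modules** [cite: BorelWallach2000, I §1.2, §5.1]:

* `GKCarrier.hom G ρ𝔤 σ𝔤 T hT𝔤 : GKCarrier G ρ𝔤 →ₗ⁅ℝ,𝔤⁆ GKCarrier G σ𝔤` — a `ℂ`-linear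
  `T : V → W` with `T ∘ ρ𝔤 X = σ𝔤 X ∘ T`, as a morphism of Lie modules; `GKCarrier.hom_comm`
  (with `T ∘ ρK k = σK k ∘ T` it intertwines the pair actions); `isCochainMapTo_hom` (`T_*` is a
  map of `(𝔤, K)`-complexes, by `ChevalleyEilenberg.Subcomplex.isCochainMapTo_gK_map_of_comm`);
* `gkCohomologyHom G ρK ρ𝔤 σK σ𝔤 had had' T hT𝔤 hTK q : H^q(𝔤, K; V) →ₗ[ℂ] H^q(𝔤, K; W)` — **the
  induced `ℂ`-linear map** (`gkCohomologyHomℝ`, `gkCohomologyHomℝ_smul`, `gkCohomologyHom_apply`;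
  `gkCohomologyMap_eq_gkCohomologyHom`: the endomorphism case is `GKCohomology.gkCohomologyMap`,
  by `rfl`);
* **functoriality**: `gkCohomologyHom_id` (`H^q(id) = id`), `gkCohomologyHom_comp`
  (`H^q(T₂ ∘ T₁) = H^q(T₂) ∘ H^q(T₁)`, with `comp_comm𝔤`, `comp_commK` supplying the composite
  intertwining relations), `gkCohomologyHom_zero` (`H^q(0) = 0`).

## Mathlib / Literature search

Builds only on the tree's `ChevalleyEilenberg*` and `GKCohomology`; Mathlib has no relative Lie
algebra cohomology.  `lean search 'gkCohomologyHom|GKCarrier.hom'`: no hits.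

## References

* A. Borel, N. Wallach (2000), I §1.2, §5.1 (held) [BorelWallach2000].
-/

noncomputable section

namespace Literature.NumberTheory.Automorphic

open Module Literature.Algebra.Lie

-- Mathlib idiom (as in `GKModules`): commutator bracket on `Module.End`
attribute [local instance 100] LieRing.ofAssociativeRing

variable {A : Type*} [NormedCommRing A] [NormedAlgebra ℝ A] [NormedAlgebra ℚ A] [CompleteSpace A]
  [StarRing A] {N : Type*} [Fintype N] [DecidableEq N] (G : RealMatrixGroup A N)
  {V : Type*} [AddCommGroup V] [Module ℂ V]
  (ρK : Representation ℂ G.maximalCompact V) (ρ𝔤 : G.lie →ₗ⁅ℝ⁆ Module.End ℂ V)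
  {W : Type*} [AddCommGroup W] [Module ℂ W]
  (σK : Representation ℂ G.maximalCompact W) (σ𝔤 : G.lie →ₗ⁅ℝ⁆ Module.End ℂ W)
  {U : Type*} [AddCommGroup U] [Module ℂ U]
  (τK : Representation ℂ G.maximalCompact U) (τ𝔤 : G.lie →ₗ⁅ℝ⁆ Module.End ℂ U)

/-- A `ℂ`-linear map intertwining the `𝔤`-actions, as a morphism of Lie modules between the
carriers. [cite: BorelWallach2000, I §1.2] -/
def GKCarrier.hom (T : V →ₗ[ℂ] W) (hT𝔤 : ∀ X : G.lie, T ∘ₗ ρ𝔤 X = σ𝔤 X ∘ₗ T) :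
    GKCarrier G ρ𝔤 →ₗ⁅ℝ,G.lie⁆ GKCarrier G σ𝔤 where
  toFun v := (T (v : V) : W)
  map_add' v w := T.map_add (v : V) (w : V)
  map_smul' t v := T.map_smul_of_tower t (v : V)
  map_lie' {X v} := LinearMap.congr_fun (hT𝔤 X) (v : V)

/-- Unfolding. [folklore] -/
@[simp] theorem GKCarrier.hom_apply (T : V →ₗ[ℂ] W) (hT𝔤 : ∀ X : G.lie, T ∘ₗ ρ𝔤 X = σ𝔤 X ∘ₗ T)
    (v : GKCarrier G ρ𝔤) : GKCarrier.hom G ρ𝔤 σ𝔤 T hT𝔤 v = T v := rfl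

/-- An intertwiner of the `K`-actions intertwines the pair actions on the carriers. [folklore] -/
theorem GKCarrier.hom_comm
    (had : ∀ (k : G.maximalCompact) (X : G.lie),
      ρK k ∘ₗ ρ𝔤 X ∘ₗ ρK k⁻¹ = ρ𝔤 (G.Ad (Subgroup.inclusion G.maximalCompact_le_carrier k) X))
    (had' : ∀ (k : G.maximalCompact) (X : G.lie),
      σK k ∘ₗ σ𝔤 X ∘ₗ σK k⁻¹ = σ𝔤 (G.Ad (Subgroup.inclusion G.maximalCompact_le_carrier k) X))
    (T : V →ₗ[ℂ] W) (hT𝔤 : ∀ X : G.lie, T ∘ₗ ρ𝔤 X = σ𝔤 X ∘ₗ T)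
    (hTK : ∀ k : G.maximalCompact, T ∘ₗ ρK k = σK k ∘ₗ T) (k : G.maximalCompact)
    (m : GKCarrier G ρ𝔤) :
    GKCarrier.hom G ρ𝔤 σ𝔤 T hT𝔤 ((gkPairAction G ρK ρ𝔤 had).τ k m) =
      (gkPairAction G σK σ𝔤 had').τ k (GKCarrier.hom G ρ𝔤 σ𝔤 T hT𝔤 m) :=
  LinearMap.congr_fun (hTK k) (m : V)

variable [StarModule ℝ A]

/-- The cochain map `T_*` is a map of `(𝔤, K)`-complexes. [cite: BorelWallach2000, I §5.1] -/
theorem isCochainMapTo_hom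
    (had : ∀ (k : G.maximalCompact) (X : G.lie),
      ρK k ∘ₗ ρ𝔤 X ∘ₗ ρK k⁻¹ = ρ𝔤 (G.Ad (Subgroup.inclusion G.maximalCompact_le_carrier k) X))
    (had' : ∀ (k : G.maximalCompact) (X : G.lie),
      σK k ∘ₗ σ𝔤 X ∘ₗ σK k⁻¹ = σ𝔤 (G.Ad (Subgroup.inclusion G.maximalCompact_le_carrier k) X))
    (T : V →ₗ[ℂ] W) (hT𝔤 : ∀ X : G.lie, T ∘ₗ ρ𝔤 X = σ𝔤 X ∘ₗ T)
    (hTK : ∀ k : G.maximalCompact, T ∘ₗ ρK k = σK k ∘ₗ T) :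
    (gkComplex G ρK ρ𝔤 had).IsCochainMapTo (gkComplex G σK σ𝔤 had')
      (ChevalleyEilenberg.map G.lie (GKCarrier.hom G ρ𝔤 σ𝔤 T hT𝔤)) :=
  ChevalleyEilenberg.Subcomplex.isCochainMapTo_gK_map_of_comm G.kInLie (gkPairAction G ρK ρ𝔤 had)
    (gkPairAction G σK σ𝔤 had') (GKCarrier.hom G ρ𝔤 σ𝔤 T hT𝔤) (fun _ => rfl)
    (GKCarrier.hom_comm G ρK ρ𝔤 σK σ𝔤 had had' T hT𝔤 hTK)

/-- The real-linear map `H^q(𝔤, K; V) → H^q(𝔤, K; W)` induced by a `(𝔤, K)`-map `T`.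
[cite: BorelWallach2000, I §5.1] -/
def gkCohomologyHomℝ
    (had : ∀ (k : G.maximalCompact) (X : G.lie),
      ρK k ∘ₗ ρ𝔤 X ∘ₗ ρK k⁻¹ = ρ𝔤 (G.Ad (Subgroup.inclusion G.maximalCompact_le_carrier k) X))
    (had' : ∀ (k : G.maximalCompact) (X : G.lie),
      σK k ∘ₗ σ𝔤 X ∘ₗ σK k⁻¹ = σ𝔤 (G.Ad (Subgroup.inclusion G.maximalCompact_le_carrier k) X))
    (T : V →ₗ[ℂ] W) (hT𝔤 : ∀ X : G.lie, T ∘ₗ ρ𝔤 X = σ𝔤 X ∘ₗ T)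
    (hTK : ∀ k : G.maximalCompact, T ∘ₗ ρK k = σK k ∘ₗ T) (q : ℕ) :
    gkCohomology G ρK ρ𝔤 had q →ₗ[ℝ] gkCohomology G σK σ𝔤 had' q :=
  (isCochainMapTo_hom G ρK ρ𝔤 σK σ𝔤 had had' T hT𝔤 hTK).cohomologyMap q

/-- The induced map commutes with the complex scalars. [folklore] -/
theorem gkCohomologyHomℝ_smul
    (had : ∀ (k : G.maximalCompact) (X : G.lie),
      ρK k ∘ₗ ρ𝔤 X ∘ₗ ρK k⁻¹ = ρ𝔤 (G.Ad (Subgroup.inclusion G.maximalCompact_le_carrier k) X))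
    (had' : ∀ (k : G.maximalCompact) (X : G.lie),
      σK k ∘ₗ σ𝔤 X ∘ₗ σK k⁻¹ = σ𝔤 (G.Ad (Subgroup.inclusion G.maximalCompact_le_carrier k) X))
    (T : V →ₗ[ℂ] W) (hT𝔤 : ∀ X : G.lie, T ∘ₗ ρ𝔤 X = σ𝔤 X ∘ₗ T)
    (hTK : ∀ k : G.maximalCompact, T ∘ₗ ρK k = σK k ∘ₗ T) (q : ℕ) (c : ℂ)
    (x : gkCohomology G ρK ρ𝔤 had q) :
    gkCohomologyHomℝ G ρK ρ𝔤 σK σ𝔤 had had' T hT𝔤 hTK q (c • x) =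
      c • gkCohomologyHomℝ G ρK ρ𝔤 σK σ𝔤 had had' T hT𝔤 hTK q x :=
  (isCochainMapTo_hom G ρK ρ𝔤 σK σ𝔤 had had' T hT𝔤 hTK).cohomologyMap_smul _
    (fun _ c f => AlternatingMap.ext fun v => T.map_smul c (f v)) q c x

/-- **`H^q(𝔤, K; −)` is a `ℂ`-linear functor on `(𝔤, K)`-modules**: the `ℂ`-linear map
`H^q(𝔤, K; V) → H^q(𝔤, K; W)` induced by a `ℂ`-linear `T : V → W` intertwining `ρ𝔤, σ𝔤` and
`ρK, σK`. [cite: BorelWallach2000, I §1.2, §5.1] -/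
def gkCohomologyHom
    (had : ∀ (k : G.maximalCompact) (X : G.lie),
      ρK k ∘ₗ ρ𝔤 X ∘ₗ ρK k⁻¹ = ρ𝔤 (G.Ad (Subgroup.inclusion G.maximalCompact_le_carrier k) X))
    (had' : ∀ (k : G.maximalCompact) (X : G.lie),
      σK k ∘ₗ σ𝔤 X ∘ₗ σK k⁻¹ = σ𝔤 (G.Ad (Subgroup.inclusion G.maximalCompact_le_carrier k) X))
    (T : V →ₗ[ℂ] W) (hT𝔤 : ∀ X : G.lie, T ∘ₗ ρ𝔤 X = σ𝔤 X ∘ₗ T)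
    (hTK : ∀ k : G.maximalCompact, T ∘ₗ ρK k = σK k ∘ₗ T) (q : ℕ) :
    gkCohomology G ρK ρ𝔤 had q →ₗ[ℂ] gkCohomology G σK σ𝔤 had' q where
  toFun := gkCohomologyHomℝ G ρK ρ𝔤 σK σ𝔤 had had' T hT𝔤 hTK q
  map_add' := map_add _
  map_smul' c x := gkCohomologyHomℝ_smul G ρK ρ𝔤 σK σ𝔤 had had' T hT𝔤 hTK q c x

/-- Unfolding to the generic induced map. [folklore] -/
theorem gkCohomologyHom_apply
    (had : ∀ (k : G.maximalCompact) (X : G.lie),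
      ρK k ∘ₗ ρ𝔤 X ∘ₗ ρK k⁻¹ = ρ𝔤 (G.Ad (Subgroup.inclusion G.maximalCompact_le_carrier k) X))
    (had' : ∀ (k : G.maximalCompact) (X : G.lie),
      σK k ∘ₗ σ𝔤 X ∘ₗ σK k⁻¹ = σ𝔤 (G.Ad (Subgroup.inclusion G.maximalCompact_le_carrier k) X))
    (T : V →ₗ[ℂ] W) (hT𝔤 : ∀ X : G.lie, T ∘ₗ ρ𝔤 X = σ𝔤 X ∘ₗ T)
    (hTK : ∀ k : G.maximalCompact, T ∘ₗ ρK k = σK k ∘ₗ T) (q : ℕ)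
    (x : gkCohomology G ρK ρ𝔤 had q) :
    gkCohomologyHom G ρK ρ𝔤 σK σ𝔤 had had' T hT𝔤 hTK q x =
      (isCochainMapTo_hom G ρK ρ𝔤 σK σ𝔤 had had' T hT𝔤 hTK).cohomologyMap q x := rfl

/-- The endomorphism case agrees with `gkCohomologyMap` of `GKCohomology`. [folklore] -/
theorem gkCohomologyMap_eq_gkCohomologyHom
    (had : ∀ (k : G.maximalCompact) (X : G.lie),
      ρK k ∘ₗ ρ𝔤 X ∘ₗ ρK k⁻¹ = ρ𝔤 (G.Ad (Subgroup.inclusion G.maximalCompact_le_carrier k) X))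
    (T : V →ₗ[ℂ] V) (hT𝔤 : ∀ X : G.lie, T ∘ₗ ρ𝔤 X = ρ𝔤 X ∘ₗ T)
    (hTK : ∀ k : G.maximalCompact, T ∘ₗ ρK k = ρK k ∘ₗ T) (q : ℕ) :
    gkCohomologyMap G ρK ρ𝔤 had T hT𝔤 hTK q =
      gkCohomologyHom G ρK ρ𝔤 ρK ρ𝔤 had had T hT𝔤 hTK q := rfl

/-- **Functoriality, identity**: `H^q(id) = id`. [cite: BorelWallach2000, I §1.2] -/
theorem gkCohomologyHom_id
    (had : ∀ (k : G.maximalCompact) (X : G.lie),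
      ρK k ∘ₗ ρ𝔤 X ∘ₗ ρK k⁻¹ = ρ𝔤 (G.Ad (Subgroup.inclusion G.maximalCompact_le_carrier k) X))
    (q : ℕ) (x : gkCohomology G ρK ρ𝔤 had q) :
    gkCohomologyHom G ρK ρ𝔤 ρK ρ𝔤 had had LinearMap.id (fun _ => rfl) (fun _ => rfl) q x = x := by
  obtain ⟨z, rfl⟩ := (gkComplex G ρK ρ𝔤 had).toCohomology_surjective q x
  rw [gkCohomologyHom_apply,
    ChevalleyEilenberg.Subcomplex.IsCochainMapTo.cohomologyMap_toCohomology]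
  congr 1

/-- **Functoriality, composition**: `H^q(T₂ ∘ T₁) = H^q(T₂) ∘ H^q(T₁)`.
[cite: BorelWallach2000, I §1.2] -/
theorem gkCohomologyHom_comp
    (had : ∀ (k : G.maximalCompact) (X : G.lie),
      ρK k ∘ₗ ρ𝔤 X ∘ₗ ρK k⁻¹ = ρ𝔤 (G.Ad (Subgroup.inclusion G.maximalCompact_le_carrier k) X))
    (had' : ∀ (k : G.maximalCompact) (X : G.lie),
      σK k ∘ₗ σ𝔤 X ∘ₗ σK k⁻¹ = σ𝔤 (G.Ad (Subgroup.inclusion G.maximalCompact_le_carrier k) X))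
    (had'' : ∀ (k : G.maximalCompact) (X : G.lie),
      τK k ∘ₗ τ𝔤 X ∘ₗ τK k⁻¹ = τ𝔤 (G.Ad (Subgroup.inclusion G.maximalCompact_le_carrier k) X))
    (T₁ : V →ₗ[ℂ] W) (h₁𝔤 : ∀ X : G.lie, T₁ ∘ₗ ρ𝔤 X = σ𝔤 X ∘ₗ T₁)
    (h₁K : ∀ k : G.maximalCompact, T₁ ∘ₗ ρK k = σK k ∘ₗ T₁)
    (T₂ : W →ₗ[ℂ] U) (h₂𝔤 : ∀ X : G.lie, T₂ ∘ₗ σ𝔤 X = τ𝔤 X ∘ₗ T₂)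
    (h₂K : ∀ k : G.maximalCompact, T₂ ∘ₗ σK k = τK k ∘ₗ T₂)
    (h𝔤 : ∀ X : G.lie, (T₂ ∘ₗ T₁) ∘ₗ ρ𝔤 X = τ𝔤 X ∘ₗ (T₂ ∘ₗ T₁))
    (hK : ∀ k : G.maximalCompact, (T₂ ∘ₗ T₁) ∘ₗ ρK k = τK k ∘ₗ (T₂ ∘ₗ T₁))
    (q : ℕ) (x : gkCohomology G ρK ρ𝔤 had q) :
    gkCohomologyHom G ρK ρ𝔤 τK τ𝔤 had had'' (T₂ ∘ₗ T₁) h𝔤 hK q x =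
      gkCohomologyHom G σK σ𝔤 τK τ𝔤 had' had'' T₂ h₂𝔤 h₂K q
        (gkCohomologyHom G ρK ρ𝔤 σK σ𝔤 had had' T₁ h₁𝔤 h₁K q x) := by
  rw [gkCohomologyHom_apply, gkCohomologyHom_apply, gkCohomologyHom_apply,
    ChevalleyEilenberg.Subcomplex.IsCochainMapTo.cohomologyMap_comp]
  exact ChevalleyEilenberg.Subcomplex.IsCochainMapTo.cohomologyMap_congr _ _
    (fun q f _ => rfl) q x

omit [StarModule ℝ A] in
/-- Intertwining relations compose (so that `gkCohomologyHom_comp` applies with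
`h𝔤 := comp_comm𝔤 …`, `hK := comp_commK …`). [folklore] -/
theorem comp_comm𝔤 (T₁ : V →ₗ[ℂ] W) (h₁𝔤 : ∀ X : G.lie, T₁ ∘ₗ ρ𝔤 X = σ𝔤 X ∘ₗ T₁)
    (T₂ : W →ₗ[ℂ] U) (h₂𝔤 : ∀ X : G.lie, T₂ ∘ₗ σ𝔤 X = τ𝔤 X ∘ₗ T₂) (X : G.lie) :
    (T₂ ∘ₗ T₁) ∘ₗ ρ𝔤 X = τ𝔤 X ∘ₗ (T₂ ∘ₗ T₁) := by
  rw [LinearMap.comp_assoc, h₁𝔤, ← LinearMap.comp_assoc, h₂𝔤, LinearMap.comp_assoc]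

omit [StarModule ℝ A] in
/-- Intertwining relations for `K` compose. [folklore] -/
theorem comp_commK (T₁ : V →ₗ[ℂ] W) (h₁K : ∀ k : G.maximalCompact, T₁ ∘ₗ ρK k = σK k ∘ₗ T₁)
    (T₂ : W →ₗ[ℂ] U) (h₂K : ∀ k : G.maximalCompact, T₂ ∘ₗ σK k = τK k ∘ₗ T₂)
    (k : G.maximalCompact) :
    (T₂ ∘ₗ T₁) ∘ₗ ρK k = τK k ∘ₗ (T₂ ∘ₗ T₁) := by
  rw [LinearMap.comp_assoc, h₁K, ← LinearMap.comp_assoc, h₂K, LinearMap.comp_assoc]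

/-- `H^q(0) = 0`. [folklore] -/
theorem gkCohomologyHom_zero
    (had : ∀ (k : G.maximalCompact) (X : G.lie),
      ρK k ∘ₗ ρ𝔤 X ∘ₗ ρK k⁻¹ = ρ𝔤 (G.Ad (Subgroup.inclusion G.maximalCompact_le_carrier k) X))
    (had' : ∀ (k : G.maximalCompact) (X : G.lie),
      σK k ∘ₗ σ𝔤 X ∘ₗ σK k⁻¹ = σ𝔤 (G.Ad (Subgroup.inclusion G.maximalCompact_le_carrier k) X))
    (q : ℕ) (x : gkCohomology G ρK ρ𝔤 had q) :
    gkCohomologyHom G ρK ρ𝔤 σK σ𝔤 had had' 0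
      (fun _ => by rw [LinearMap.zero_comp, LinearMap.comp_zero])
      (fun _ => by rw [LinearMap.zero_comp, LinearMap.comp_zero]) q x = 0 := by
  obtain ⟨z, rfl⟩ := (gkComplex G ρK ρ𝔤 had).toCohomology_surjective q x
  rw [gkCohomologyHom_apply,
    ChevalleyEilenberg.Subcomplex.IsCochainMapTo.cohomologyMap_toCohomology, ← map_zero
      ((gkComplex G σK σ𝔤 had').toCohomology q)]
  congr 1

end Literature.NumberTheory.Automorphic
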